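import Summits.CriticalPhenomena.PercolationContinuityZ3.Theorems.Transplant.PlanarSkeletonFrmQuasiDefs
import Summits.CriticalPhenomena.PercolationContinuityZ3.Theorems.Transplant.SkelFrmQuasiBChoiceDefs3
import Summits.CriticalPhenomena.PercolationContinuityZ3.Theorems.Transplant.SkelFrmBChoiceDefs3
import Summits.CriticalPhenomena.PercolationContinuityZ3.Theorems.Transplant.SkelPhiCellsSmallMT
import Summits.CriticalPhenomena.PercolationContinuityZ3.Theorems.Transplant.SkelFrmQuasi1ChoiceDefs
import Summits.CriticalPhenomena.PercolationContinuityZ3.Theorems.Transplant.SkelFrmQuasi1ParamsLBL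
import Summits.CriticalPhenomena.PercolationContinuityZ3.Theorems.Transplant.SkelFrmQuasi1ParamsLF
import Summits.CriticalPhenomena.PercolationContinuityZ3.Theorems.Transplant.SkelFrmQuasi1ParamsPO
import Summits.CriticalPhenomena.PercolationContinuityZ3.Theorems.Transplant.SkelFrmQuasi1SlotTypes
import Summits.CriticalPhenomena.PercolationContinuityZ3.Theorems.Transplant.SkelFrmQuasiBChoiceDefs
import Summits.CriticalPhenomena.PercolationContinuityZ3.Theorems.Transplant.SkelFrmQuasiBParamsLFA
import Summits.CriticalPhenomena.PercolationContinuityZ3.Theorems.Transplant.SkelFrmQuasiBParamsLOA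
import Summits.CriticalPhenomena.PercolationContinuityZ3.Theorems.Transplant.SkelFrmQuasi1SlotTypes
import HarnessLib
import Summits.CriticalPhenomena.PercolationContinuityZ3.Theorems.Transplant.SkelFrmBChoiceDefsT
/-!
# GEN-Q PORT (WAVE-Q table v0.8 section 2, row G048, U-level L9; captain R-6/R-7 2026-08-27: carrier token swap `PlanarSkeletonFrmFrom ↦ PlanarSkeletonFrmQuasi`)
# of the tree module «Transplant/SkelFrmFromBChoiceDefsT» (sha256 60de5bf2a611753a…) onto the quasi-step carrier `PlanarSkeletonFrmQuasi` (p507026): «SkelFrmQuasiBChoiceDefsT»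

ORIGINAL TITLE: N2 (frames-only node `SamePDropOfSkeletonFrm₁`, OPEN), WAVE 1 under (R-40): THE CHOICE FUNCTION OF RECORD OVER THE PER-AXIS-CAPPED STAGGERED CELLS

builds on p205010 (kernel theorem, internal audit signed; external expert review pending) — nothing in this file uses p205010; NOTHING is claimed about any open node
((N3-b), the end state).  Lane `prim-bschramm`, seat `prim-bschramm-p3` (gen 30; design owner; tool = captain gen-1 g4's port_genq.py R-14 --cone + p3-g30 slot-value patch T1).  Helper file (`--supports stmt-CriticalPhenomena-4575 --as helper`).
PORT RULES (U-wave r1–r4 re-used, GEN-Q hunk classes of p3-g29 #6136): declaration order, names and proof texts are those of «SkelFrmFromBChoiceDefsT», byte-identical except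
(i) the carrier token `PlanarSkeletonFrmFrom ↦ PlanarSkeletonFrmQuasi` in binders, `namespace`/`end` lines and qualified names (module names `SkelFrmFrom… ↦ SkelFrmQuasi…`
in imports of already-ported rows); (ii) `Φ.step ↦ Φ.qstep` with the called Steps lemma replaced by its `…Q`/`_q` twin and the cost `Φ.M` threaded (none in this file unless
listed below); (iii) `Φ.cyl_connected ↦ Φ.cyl_reach` readers (none unless listed); (iv) graph-ball radii / window floors ×`Φ.M` — IN THIS FILE the offset floor of record `offNT x := Φ.M · NrepA (cenS x) + 1` (was `NrepA (cenS x) + 1`) and accordingly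
`colQ_schedOfT : Φ.M · NrepA (cenS x) + 1 ≤ rQ a x`; consumers: «…BParamsSchedAT» `offNT_le` (constant `Φ.M · cOffS`), `hoffNT_at` (the quasi `hoffN` shape of «SkelPhiFaceRunNb2VQ» :55 at `M := Φ.M`).  Carrier-free
residents stay imported/exported from the original «SkelFrmBChoiceDefsT» exactly as in the FrmFrom port.  Docstrings and citations are the original's.

-/

noncomputable section

open scoped Classical

namespace Summit.CriticalPhenomena.PercolationContinuityZ3.Theorems.Transplant

open MeasureTheory Literature.Probability.Percolation Literature.Probability.LatticeModels SimpleGraph KNCells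
open Literature.Barriers.CriticalPhenomena (HasExponentialGrowth)
open Literature.Probability.Percolation.KozmaNitzan.Cells (oth oth_oth)

namespace PlanarSkeletonFrmQuasi

open SkelConc (Consts)
open BoxProdZ2 (ConcRadiiG)
open Skelφ (oriφ trφ)
open Skelφ.StepI (DataN DataNS OutNS)

namespace NegB

open Neg

/-! ## §1 The per-axis truncated creep and the staggered cells of record under (R-40) -/

section Values

variable (κ : Consts) {V : Type} [DecidableEq V] [Countable V] {G : SimpleGraph V} [G.LocallyFinite] (Φ : PlanarSkeletonFrmQuasi G) (t : V)
  (p : unitInterval) (D : DataNS V) (g f : ℕ) (c : Fin 2 → ℕ)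

/-- **The PER-AXIS truncated creep** `cT i := min (c i) (r (oth i))` (the creep of a step along `i` is felt on the other coordinate, so it is capped by the OTHER
unit: `c 0 ≤ r 1 = K·s₁`, `c 1 ≤ r 0 = K·s₀`). [this work] -/
def cT (κ : Consts) {V : Type} [DecidableEq V] [Countable V] {G : SimpleGraph V} [G.LocallyFinite] (Φ : PlanarSkeletonFrmQuasi G) (t : V) (p : unitInterval) (D : DataNS V) (g : ℕ) (f : ℕ) (c : Fin 2 → ℕ) (i : Fin 2) : ℕ := min (c i) ((fcellsA κ Φ t p D g f).r (oth i))

/-- `cT i ≤ r (oth i)` and `cT i ≤ c i`. [folklore] -/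
theorem cT_le (κ : Consts) {V : Type} [DecidableEq V] [Countable V] {G : SimpleGraph V} [G.LocallyFinite] (Φ : PlanarSkeletonFrmQuasi G) (t : V) (p : unitInterval) (D : DataNS V) (g : ℕ) (f : ℕ) (c : Fin 2 → ℕ) (i : Fin 2) : cT κ Φ t p D g f c i ≤ (fcellsA κ Φ t p D g f).r (oth i) ∧ cT κ Φ t p D g f c i ≤ c i := ⟨min_le_right _ _, min_le_left _ _⟩

/-- **Under the ledger row `c i ≤ r (oth i)` the truncation is the identity**: `cT i = c i`. [folklore] -/
theorem cT_eq (κ : Consts) {V : Type} [DecidableEq V] [Countable V] {G : SimpleGraph V} [G.LocallyFinite] (Φ : PlanarSkeletonFrmQuasi G) (t : V) (p : unitInterval) (D : DataNS V) (g : ℕ) (f : ℕ) (c : Fin 2 → ℕ) (h : ∀ i, c i ≤ (fcellsA κ Φ t p D g f).r (oth i)) (i : Fin 2) : cT κ Φ t p D g f c i = c i := min_eq_left (h i)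

-- GEN-Q (R-2, captain 2026-08-27): `PlanarSkeletonFrmFrom.NegB.cT_eq'` is not in the used cone of the node top — not ported.

/-- **THE STAGGERED CELLS OF RECORD OF THE N2 CHAIN UNDER (R-40)** (`PCells2T`, per-axis creep cap): the cells `fcellsA` of the (ζ′) chain with the per-axis truncated
creep `cT` toward the onward quadrant — total in the slot value `c`, and a GENUINE `PCells2T` (`c 0` may reach `K·s₁`). [cite: KozmaNitzan2024, §4 p. 25 (the renormalised lattice)] -/
def fcellsT (κ : Consts) {V : Type} [DecidableEq V] [Countable V] {G : SimpleGraph V} [G.LocallyFinite] (Φ : PlanarSkeletonFrmQuasi G) (t : V) (p : unitInterval) (D : DataNS V) (g : ℕ) (f : ℕ) (c : Fin 2 → ℕ) : PCells2T where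
  toPCells2 := fcellsA κ Φ t p D g f
  c := fun i => ((cT κ Φ t p D g f c i : ℕ) : ℤ)
  hc0 := fun i => Int.natCast_nonneg _
  hcr := fun i => by exact_mod_cast (cT_le κ Φ t p D g f c i).1

-- GEN-Q (R-2, captain 2026-08-27): `PlanarSkeletonFrmFrom.NegB.fcellsT_toPCells2` is not in the used cone of the node top — not ported.

/-- `r` of the T-staggered cells is `fcellsA`'s (by `rfl`). [folklore] -/
theorem fcellsT_r (κ : Consts) {V : Type} [DecidableEq V] [Countable V] {G : SimpleGraph V} [G.LocallyFinite] (Φ : PlanarSkeletonFrmQuasi G) (t : V) (p : unitInterval) (D : DataNS V) (g : ℕ) (f : ℕ) (c : Fin 2 → ℕ) (i : Fin 2) : (fcellsT κ Φ t p D g f c).r i = (fcellsA κ Φ t p D g f).r i := rfl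

-- GEN-Q (R-2, captain 2026-08-27): `PlanarSkeletonFrmFrom.NegB.fcellsT_s` is not in the used cone of the node top — not ported.

-- GEN-Q (R-2, captain 2026-08-27): `PlanarSkeletonFrmFrom.NegB.fcellsT_K` is not in the used cone of the node top — not ported.

/-- The creep field (by `rfl`). [folklore] -/
theorem fcellsT_c (κ : Consts) {V : Type} [DecidableEq V] [Countable V] {G : SimpleGraph V} [G.LocallyFinite] (Φ : PlanarSkeletonFrmQuasi G) (t : V) (p : unitInterval) (D : DataNS V) (g : ℕ) (f : ℕ) (c : Fin 2 → ℕ) (i : Fin 2) : (fcellsT κ Φ t p D g f c).c i = ((cT κ Φ t p D g f c i : ℕ) : ℤ) := rfl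

-- GEN-Q (R-2, captain 2026-08-27): `PlanarSkeletonFrmFrom.NegB.fcellsT_c_le` is not in the used cone of the node top — not ported.

-- GEN-Q (R-2, captain 2026-08-27): `PlanarSkeletonFrmFrom.NegB.fcellsT_c_le_r_oth` is not in the used cone of the node top — not ported.

/-- **Under the ledger row `c i ≤ r (oth i)` the creep IS the slot value.** [folklore] -/
theorem fcellsT_c_eq (κ : Consts) {V : Type} [DecidableEq V] [Countable V] {G : SimpleGraph V} [G.LocallyFinite] (Φ : PlanarSkeletonFrmQuasi G) (t : V) (p : unitInterval) (D : DataNS V) (g : ℕ) (f : ℕ) (c : Fin 2 → ℕ) (h : ∀ i, c i ≤ (fcellsA κ Φ t p D g f).r (oth i)) (i : Fin 2) : (fcellsT κ Φ t p D g f c).c i = c i := by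
  rw [fcellsT_c, cT_eq κ Φ t p D g f c h]

-- GEN-Q (R-2, captain 2026-08-27): `PlanarSkeletonFrmFrom.NegB.fcellsT_c_eq'` is not in the used cone of the node top — not ported.

-- GEN-Q (R-2, captain 2026-08-27): `PlanarSkeletonFrmFrom.NegB.fcellsT_cenS_zero` is not in the used cone of the node top — not ported.

-- GEN-Q (R-2, captain 2026-08-27): `PlanarSkeletonFrmFrom.NegB.fcellsS_toT_toPCells2` is not in the used cone of the node top — not ported.

-- GEN-Q (R-2, captain 2026-08-27): `PlanarSkeletonFrmFrom.NegB.fcellsT_cenS_eq_of_uniform` is not in the used cone of the node top — not ported.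

/-! ## §2 The column slot at the T-staggered centre, the schedule, the arrival half-widths -/

/-- **The column slot of record, read at the T-STAGGERED centre** — GEN-Q hunk (iv), the ×M offset floor of record (design owner p3-g30 after p5-g28's Q49 read #6227):
`offNT x := Φ.M · NrepA (cenS x) + 1` (the quasi `hcolQ`/`hoffN` rows read `M·‖rep₂ (cenS x)‖₁ + 1 ≤ rQ a x` — the vertex over a chart point at ℓ¹-distance `‖z‖₁` lies within
graph distance `Φ.M·‖z‖₁`, «SkelPhiQStepsN» `QStepsN.exists_mem_graphBall_eq`; FrmFrom is the case `M = 1`). [this work] -/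
def offNT (κ : Consts) {V : Type} [DecidableEq V] [Countable V] {G : SimpleGraph V} [G.LocallyFinite] (Φ : PlanarSkeletonFrmQuasi G) (t : V) (p : unitInterval) (D : DataNS V) (g : ℕ) (f : ℕ) (c : Fin 2 → ℕ) : Site 2 → ℕ := fun x => Φ.M * NrepA κ Φ t p D g f ((fcellsT κ Φ t p D g f c).cenS x) + 1

/-- **The radius schedule of record over the T-staggered cells**: `schedOfT S := Prm.schedN S fcellsA offNT` (numbers over the underlying `PCells2`; the column slot at
`cenS`). [this work] -/
def schedOfT (κ : Consts) {V : Type} [DecidableEq V] [Countable V] {G : SimpleGraph V} [G.LocallyFinite] (Φ : PlanarSkeletonFrmQuasi G) (t : V) (p : unitInterval) (D : DataNS V) (g : ℕ) (f : ℕ) (c : Fin 2 → ℕ) (S : Skelφ.Prm.SchedIn) : ConcRadiiG := Skelφ.Prm.schedN S (fcellsA κ Φ t p D g f) (offNT κ Φ t p D g f c)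

-- GEN-Q (R-2, captain 2026-08-27): `PlanarSkeletonFrmFrom.NegB.schedOfT_eq` is not in the used cone of the node top — not ported.

/-- **`WFS2 (fcellsT …).toPCells2 (schedOfT S)`** for every input block and every slot value. [this work] -/
theorem schedOfT_WFS2 (κ : Consts) {V : Type} [DecidableEq V] [Countable V] {G : SimpleGraph V} [G.LocallyFinite] (Φ : PlanarSkeletonFrmQuasi G) (t : V) (p : unitInterval) (D : DataNS V) (g : ℕ) (f : ℕ) (c : Fin 2 → ℕ) (S : Skelφ.Prm.SchedIn) : Skelφ.WFS2 (fcellsT κ Φ t p D g f c).toPCells2 (schedOfT κ Φ t p D g f c S) := Skelφ.Prm.schedN_WFS2 _ _ _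

/-- **The column floor at the T-staggered centre** (×M, hunk (iv)): `Φ.M · NrepA (cenS x) + 1 ≤ rQ a x`. [folklore] -/
theorem colQ_schedOfT (κ : Consts) {V : Type} [DecidableEq V] [Countable V] {G : SimpleGraph V} [G.LocallyFinite] (Φ : PlanarSkeletonFrmQuasi G) (t : V) (p : unitInterval) (D : DataNS V) (g : ℕ) (f : ℕ) (c : Fin 2 → ℕ) (S : Skelφ.Prm.SchedIn) : ∀ a x, Φ.M * NrepA κ Φ t p D g f ((fcellsT κ Φ t p D g f c).cenS x) + 1 ≤ (schedOfT κ Φ t p D g f c S).rQ a x :=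
  fun a x => Skelφ.Prm.off_le_schedN_rQ S (fcellsA κ Φ t p D g f) (offNT κ Φ t p D g f c) a x

variable (b : Fin 2 → ℕ)

/-- **`bS i ≤ 3·r i`** (SmallMT's `Mb_subset_M` row `hb`), stated over the T-staggered cells, for EVERY slot value (`bS` is p348247's cell-agnostic truncation). [folklore] -/
theorem bS_leT (κ : Consts) {V : Type} [DecidableEq V] [Countable V] {G : SimpleGraph V} [G.LocallyFinite] (Φ : PlanarSkeletonFrmQuasi G) (t : V) (p : unitInterval) (D : DataNS V) (g : ℕ) (f : ℕ) (c : Fin 2 → ℕ) (b : Fin 2 → ℕ) (i : Fin 2) : bS κ Φ t p D g f b i ≤ 3 * (fcellsT κ Φ t p D g f c).r i := by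
  rw [fcellsT_r]; exact min_le_right _ _

/-! ## §3 The scheme of record, the choices -/

variable (Pv : PSlot) (O : OutNS V) (gv fv : Neg.FSlot) (Sv : SSlot) (cv : CSlot) (bv : BSlot) (q : unitInterval)

/-- `bOf ≤ 3r` over the T-staggered cells, for every slot value. [folklore] -/
theorem bOf_leT (κ : Consts) {V : Type} [DecidableEq V] [Countable V] {G : SimpleGraph V} [G.LocallyFinite] (Φ : PlanarSkeletonFrmQuasi G) (t : V) (p : unitInterval) (O : OutNS V) (gv : Neg.FSlot) (fv : Neg.FSlot) (cv : CSlot) (bv : BSlot) (i : Fin 2) :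
    bOf κ Φ t p O gv fv bv i ≤ 3 * (fcellsT κ Φ t p O.merged (gOf κ Φ t p O gv) (fOf κ Φ t p O fv) (cOf κ Φ t p O gv fv cv)).r i :=
  bS_leT κ Φ t p O.merged _ _ _ _ i

/-- **THE SCHEME OF RECORD OF THE N2 CHAIN at `(O, q)` UNDER (R-40)**: `cellGeomSG₂bT` over the oriented (ζ′) fine map `fineOA`, the T-STAGGERED cells `fcellsT`, root
`t`, schedule `schedOfT (Sv …)`, arrival boxes `bOf` (slot `bv`, truncated at `3r`). [cite: KozmaNitzan2024, §4 pp. 25–27 (Q_v, M_v, E_{v,x}, H^j_{v,x})] -/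
def ΓQT (κ : Consts) {V : Type} [DecidableEq V] [Countable V] {G : SimpleGraph V} [G.LocallyFinite] (Φ : PlanarSkeletonFrmQuasi G) (t : V) (p : unitInterval) (O : OutNS V) (gv : Neg.FSlot) (fv : Neg.FSlot) (Sv : SSlot) (cv : CSlot) (bv : BSlot) (q : unitInterval) : CellGeom V ℕ :=
  Skelφ.cellGeomSG₂bT G (fineOA κ Φ t p O.D O.DT.toDataN O.ori (gOf κ Φ t p O gv) (fOf κ Φ t p O fv))
    (fcellsT κ Φ t p O.merged (gOf κ Φ t p O gv) (fOf κ Φ t p O fv) (cOf κ Φ t p O gv fv cv)) t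
    (schedOfT κ Φ t p O.merged (gOf κ Φ t p O gv) (fOf κ Φ t p O fv) (cOf κ Φ t p O gv fv cv)
      (Sv κ Φ t p O.merged (gOf κ Φ t p O gv) (fOf κ Φ t p O fv) q))
    (bOf κ Φ t p O gv fv bv)

/-- **The face data of the N2 chain at `(O, q)` under (R-40)** (`faceDataSGT` over `fineOA`/`fcellsT`/`schedOfT`). [this work] -/
def FDQT (κ : Consts) {V : Type} [DecidableEq V] [Countable V] {G : SimpleGraph V} [G.LocallyFinite] (Φ : PlanarSkeletonFrmQuasi G) (t : V) (p : unitInterval) (O : OutNS V) (gv : Neg.FSlot) (fv : Neg.FSlot) (Sv : SSlot) (cv : CSlot) (q : unitInterval) : FaceData V ℕ :=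
  Skelφ.faceDataSGT G (fineOA κ Φ t p O.D O.DT.toDataN O.ori (gOf κ Φ t p O gv) (fOf κ Φ t p O fv))
    (fcellsT κ Φ t p O.merged (gOf κ Φ t p O gv) (fOf κ Φ t p O fv) (cOf κ Φ t p O gv fv cv)) t
    (schedOfT κ Φ t p O.merged (gOf κ Φ t p O gv) (fOf κ Φ t p O fv) (cOf κ Φ t p O gv fv cv)
      (Sv κ Φ t p O.merged (gOf κ Φ t p O gv) (fOf κ Φ t p O fv) q))

/-- **The level data of the N2 chain at `O` under (R-40)** (`levelDataST` over `fineOA`/`fcellsT`). [this work] -/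
def LDQT (κ : Consts) {V : Type} [DecidableEq V] [Countable V] {G : SimpleGraph V} [G.LocallyFinite] (Φ : PlanarSkeletonFrmQuasi G) (t : V) (p : unitInterval) (O : OutNS V) (gv : Neg.FSlot) (fv : Neg.FSlot) (cv : CSlot) : LevelData V ℕ :=
  Skelφ.levelDataST (fineOA κ Φ t p O.D O.DT.toDataN O.ori (gOf κ Φ t p O gv) (fOf κ Φ t p O fv))
    (fcellsT κ Φ t p O.merged (gOf κ Φ t p O gv) (fOf κ Φ t p O fv) (cOf κ Φ t p O gv fv cv))

-- GEN-Q (R-2, captain 2026-08-27): `PlanarSkeletonFrmFrom.NegB.ΓQT_root` is not in the used cone of the node top — not ported.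

-- GEN-Q (R-2, captain 2026-08-27): `PlanarSkeletonFrmFrom.NegB.ΓQT_a₀` is not in the used cone of the node top — not ported.

-- GEN-Q (R-2, captain 2026-08-27): `PlanarSkeletonFrmFrom.NegB.ΓQT_K` is not in the used cone of the node top — not ported.

-- GEN-Q (R-2, captain 2026-08-27): `PlanarSkeletonFrmFrom.NegB.ΓQT_M` is not in the used cone of the node top — not ported.

-- GEN-Q (R-2, captain 2026-08-27): `PlanarSkeletonFrmFrom.NegB.ΓQT_Q` is not in the used cone of the node top — not ported.

-- GEN-Q (R-2, captain 2026-08-27): `PlanarSkeletonFrmFrom.NegB.ΓQT_Efar` is not in the used cone of the node top — not ported.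

-- GEN-Q (R-2, captain 2026-08-27): `PlanarSkeletonFrmFrom.NegB.ΓQT_anchSet` is not in the used cone of the node top — not ported.

variable (hC : Φ.CylSubcritical p)

/-- **THE N2 CHOICES OF RECORD at `(κ, Φ, t, p)` UNDER (R-40), six slots, Step-I‴ accuracy at the CUBE** — `δI := δI3` ((R-33)), `m₀`, `Sz`, `SMn := SMnP` as in
p348247, `Γ := ΓQT`, `FD := FDQT`, `LD := LDQT`. [cite: KozmaNitzan2024, §4 Theorem 6 (pp. 25–31)] -/
def choiceAtQ3T (κ : Consts) {V : Type} [DecidableEq V] [Countable V] {G : SimpleGraph V} [G.LocallyFinite] (Φ : PlanarSkeletonFrmQuasi G) (t : V) (p : unitInterval) (Pv : PSlot) (gv : Neg.FSlot) (fv : Neg.FSlot) (Sv : SSlot) (cv : CSlot) (bv : BSlot) (hC : Φ.CylSubcritical p) : ChoiceNQ κ Φ t p hC where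
  δI := δI3 κ Φ
  m₀ := Neg.m₀
  Sz := fun O => Neg.Sz O.merged
  SMn := fun O => SMnP κ Φ t p O.merged (gOf κ Φ t p O gv) (fOf κ Φ t p O fv) Pv
  Γ := fun O q => ΓQT κ Φ t p O gv fv Sv cv bv q
  FD := fun O q => FDQT κ Φ t p O gv fv Sv cv q
  LD := fun O _ => LDQT κ Φ t p O gv fv cv
  δI_pos := δI3_pos κ Φ
  δI_lt_one := δI3_lt_one κ Φ
  S_adm := fun O _ => ⟨Neg.Sz_adm O.merged, SMnP_adm_at κ Φ t p O.merged _ _ Pv⟩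

/-- The Step-I‴ accuracy of the T choices of record is `δI3` (by `rfl`). [folklore] -/
@[simp] theorem choiceAtQ3T_δI (κ : Consts) {V : Type} [DecidableEq V] [Countable V] {G : SimpleGraph V} [G.LocallyFinite] (Φ : PlanarSkeletonFrmQuasi G) (t : V) (p : unitInterval) (Pv : PSlot) (gv : Neg.FSlot) (fv : Neg.FSlot) (Sv : SSlot) (cv : CSlot) (bv : BSlot) (hC : Φ.CylSubcritical p) : (choiceAtQ3T κ Φ t p Pv gv fv Sv cv bv hC).δI = δI3 κ Φ := rfl

/-- The least seed level is the landed one (by `rfl`). [folklore] -/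
@[simp] theorem choiceAtQ3T_m₀ (κ : Consts) {V : Type} [DecidableEq V] [Countable V] {G : SimpleGraph V} [G.LocallyFinite] (Φ : PlanarSkeletonFrmQuasi G) (t : V) (p : unitInterval) (Pv : PSlot) (gv : Neg.FSlot) (fv : Neg.FSlot) (Sv : SSlot) (cv : CSlot) (bv : BSlot) (hC : Φ.CylSubcritical p) : (choiceAtQ3T κ Φ t p Pv gv fv Sv cv bv hC).m₀ = (choiceAtQ3 κ Φ t p Pv gv fv Sv cv bv hC).m₀ := rfl

/-- The zone sizes are the landed ones (by `rfl`). [folklore] -/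
@[simp] theorem choiceAtQ3T_Sz (κ : Consts) {V : Type} [DecidableEq V] [Countable V] {G : SimpleGraph V} [G.LocallyFinite] (Φ : PlanarSkeletonFrmQuasi G) (t : V) (p : unitInterval) (Pv : PSlot) (gv : Neg.FSlot) (fv : Neg.FSlot) (Sv : SSlot) (cv : CSlot) (bv : BSlot) (hC : Φ.CylSubcritical p) : (choiceAtQ3T κ Φ t p Pv gv fv Sv cv bv hC).Sz = (choiceAtQ3 κ Φ t p Pv gv fv Sv cv bv hC).Sz := rfl

/-- The admissible pairs are the landed ones (by `rfl`; the pair slot `Pv` is read exactly as before). [folklore] -/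
@[simp] theorem choiceAtQ3T_SMn (κ : Consts) {V : Type} [DecidableEq V] [Countable V] {G : SimpleGraph V} [G.LocallyFinite] (Φ : PlanarSkeletonFrmQuasi G) (t : V) (p : unitInterval) (Pv : PSlot) (gv : Neg.FSlot) (fv : Neg.FSlot) (Sv : SSlot) (cv : CSlot) (bv : BSlot) (hC : Φ.CylSubcritical p) : (choiceAtQ3T κ Φ t p Pv gv fv Sv cv bv hC).SMn = (choiceAtQ3 κ Φ t p Pv gv fv Sv cv bv hC).SMn := rfl

-- GEN-Q (R-2, captain 2026-08-27): `PlanarSkeletonFrmFrom.NegB.choiceAtQ3T_Γ` is not in the used cone of the node top — not ported.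

-- GEN-Q (R-2, captain 2026-08-27): `PlanarSkeletonFrmFrom.NegB.choiceAtQ3T_FD` is not in the used cone of the node top — not ported.

-- GEN-Q (R-2, captain 2026-08-27): `PlanarSkeletonFrmFrom.NegB.choiceAtQ3T_LD` is not in the used cone of the node top — not ported.

-- GEN-Q (R-2, captain 2026-08-27): `PlanarSkeletonFrmFrom.NegB.choiceAtQ3T_scheme` is not in the used cone of the node top — not ported.

end Values

end NegB

/-! ## §4 The choice function of record under (R-40) -/

-- GEN-Q (R-2, captain 2026-08-27): `PlanarSkeletonFrmFrom.frmChoiceAllQ3T` is not in the used cone of the node top — not ported.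

-- GEN-Q (R-2, captain 2026-08-27): `PlanarSkeletonFrmFrom.frmChoiceAllQ3T_eq` is not in the used cone of the node top — not ported.

-- GEN-Q (R-2, captain 2026-08-27): `PlanarSkeletonFrmFrom.frmChoiceAllQ3T_scheme` is not in the used cone of the node top — not ported.

end PlanarSkeletonFrmQuasi

end Summit.CriticalPhenomena.PercolationContinuityZ3.Theorems.Transplant

end
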